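import Literature.NumberTheory.ModularForms.PoincareSeriesWeightTwoHeckeConvergence
import Mathlib.Analysis.Normed.Group.FunctionSeries
import HarnessLib

/-!
# The Hecke-regularised weight-2 Poincaré series is continuous on `ℍ` (`s > 0`)

Topic `Literature/NumberTheory/ModularForms` (namespace `Literature.NumberTheory.ModularForms.PoincareWeightTwo`,
continuing `PoincareSeriesWeightTwoHecke.lean` / `…HeckeConvergence.lean`). THEOREMS ONLY. For `s > 0`
the series `P_m(z,s) = ½ Σ_{(c,d)} (cz+d)⁻² |cz+d|^{−2s} e(mγ_{(c,d)}z)` converges uniformly on every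
vertical strip `|Re z| ≤ A, Im z ≥ B` (Mathlib's Eisenstein majorant on strips,
`EisensteinSeries.summand_bound_of_mem_verticalStrip`, exponent `2 + 2s > 2`), hence defines a
continuous function of `z` on `ℍ` (Iwaniec–Kowalski §14.1 (14.4) with Hecke's factor, §3.2). This is
item (i) of the domination stub T4a (`HeckeDomination`) of the I1 fact skeleton
`Summits/Parity/GeneralizedHardyLittlewood/Cruxes/PeterssonBoundPrinted/Lines/poincare_hecke.lean`, and
the measurability input of the unfolding/`L²` steps.

* `continuous_poincareTerm` — each term is continuous in `z`;
* `continuousOn_poincareHecke_verticalStrip`, `continuous_poincareHecke` — `P_m(·,s)` is continuous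
  (`s > 0`); `continuous_rpow_im_mul_poincareHecke` — so is `yˢ P_m(z,s)`.

## References

* [IwaniecKowalski2004] H. Iwaniec, E. Kowalski, *Analytic Number Theory*, §14.1 (14.4), §3.2.
-/

noncomputable section

open scoped MatrixGroups Real Topology
open CongruenceSubgroup Complex Filter
open UpperHalfPlane hiding I

namespace Literature.NumberTheory.ModularForms.PoincareWeightTwo

variable {N : ℕ}

/-- `z ↦ cz + d` is continuous on `ℍ`. [cite: IwaniecKowalski2004, §14.1 (14.4)] -/
theorem continuous_rowDenom (v : Fin 2 → ℤ) : Continuous fun z : ℍ ↦ rowDenom v z := by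
  unfold rowDenom
  fun_prop

/-- **Each term of the Poincaré series is continuous in `z`.** [cite: IwaniecKowalski2004, §14.1 (14.4)] -/
theorem continuous_poincareTerm (m : ℕ) (s : ℝ) (v : Row N) :
    Continuous fun z : ℍ ↦ poincareTerm N m s v z := by
  have h0 : ∀ z : ℍ, rowDenom v.1 z ≠ 0 := fun z ↦ rowDenom_ne_zero v.1 v.2.1 z
  unfold poincareTerm
  refine Continuous.mul (Continuous.mul ?_ ?_) ?_
  · exact Continuous.inv₀ ((continuous_rowDenom v.1).pow 2) fun z ↦ pow_ne_zero _ (h0 z)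
  · refine Complex.continuous_ofReal.comp ?_
    exact Continuous.rpow_const (continuous_norm.comp (continuous_rowDenom v.1))
      fun z ↦ Or.inl (norm_ne_zero_iff.mpr (h0 z))
  · refine Complex.continuous_exp.comp (Continuous.mul continuous_const ?_)
    refine UpperHalfPlane.continuous_coe.comp ?_
    change Continuous (fun z : ℍ ↦ ((((rowMatrix v.1 v.2.1 : SL(2, ℤ)) : GL (Fin 2) ℝ) • z : ℍ)))
    exact continuous_const_smul _

/-- **Uniform convergence on vertical strips ⇒ continuity there**: for `s > 0` and `B > 0`,
`P_m(·,s)` is continuous on `{|Re z| ≤ A, Im z ≥ B}` (majorant `r(A,B)^{−(2+2s)} ‖(c,d)‖^{−(2+2s)}`,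
Mathlib `EisensteinSeries.summand_bound_of_mem_verticalStrip` and `summable_one_div_norm_rpow`).
[cite: IwaniecKowalski2004, §14.1 (14.4) with §3.2] -/
theorem continuousOn_poincareHecke_verticalStrip (m : ℕ) {s : ℝ} (hs : 0 < s) (A : ℝ) {B : ℝ}
    (hB : 0 < B) : ContinuousOn (fun z : ℍ ↦ poincareHecke N m s z) (verticalStrip A B) := by
  have hk : 0 ≤ 2 + 2 * s := by linarith
  have hu : Summable fun v : Row N ↦
      EisensteinSeries.r ⟨⟨A, B⟩, hB⟩ ^ (-(2 + 2 * s)) * ‖v.1‖ ^ (-(2 + 2 * s)) :=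
    ((EisensteinSeries.summable_one_div_norm_rpow (by linarith : 2 < 2 + 2 * s)).mul_left _).subtype _
  have hts : ContinuousOn (fun z : ℍ ↦ ∑' v : Row N, poincareTerm N m s v z) (verticalStrip A B) := by
    refine continuousOn_tsum (fun v ↦ (continuous_poincareTerm m s v).continuousOn) hu ?_
    intro v z hz
    refine (norm_poincareTerm_le m s v z).trans ?_
    have h := EisensteinSeries.summand_bound_of_mem_verticalStrip hk v.1 hB hz
    simpa [rowDenom] using h
  unfold poincareHecke
  exact continuousOn_const.mul hts

/-- **`P_m(·,s)` is continuous on `ℍ` for `s > 0`.** [cite: IwaniecKowalski2004, §14.1 (14.4) with §3.2] -/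
theorem continuous_poincareHecke (m : ℕ) {s : ℝ} (hs : 0 < s) :
    Continuous fun z : ℍ ↦ poincareHecke N m s z := by
  refine continuous_iff_continuousAt.mpr fun z₀ ↦ ?_
  -- a strip neighbourhood of `z₀`
  have hB : 0 < z₀.im / 2 := by have := z₀.im_pos; linarith
  have hmem : verticalStrip (|z₀.re| + 1) (z₀.im / 2) ∈ 𝓝 z₀ := by
    have ho : IsOpen {z : ℍ | |z.re| < |z₀.re| + 1 ∧ z₀.im / 2 < z.im} :=
      (isOpen_lt (continuous_abs.comp UpperHalfPlane.continuous_re) continuous_const).inter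
        (isOpen_lt continuous_const UpperHalfPlane.continuous_im)
    refine Filter.mem_of_superset (ho.mem_nhds ⟨by linarith [abs_nonneg z₀.re], by linarith [z₀.im_pos]⟩) ?_
    intro z hz
    exact ⟨hz.1.le, hz.2.le⟩
  exact (continuousOn_poincareHecke_verticalStrip (N := N) m hs _ hB).continuousAt hmem

/-- **`z ↦ yˢ P_m(z,s)` is continuous** (`s > 0`) — item (i) of `HeckeDomination`.
[cite: IwaniecKowalski2004, §14.1 (14.4) with §3.2] -/
theorem continuous_rpow_im_mul_poincareHecke (m : ℕ) {s : ℝ} (hs : 0 < s) :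
    Continuous fun z : ℍ ↦ ((z.im ^ s : ℝ) : ℂ) * poincareHecke N m s z := by
  refine Continuous.mul ?_ (continuous_poincareHecke m hs)
  refine Complex.continuous_ofReal.comp ?_
  exact Continuous.rpow_const UpperHalfPlane.continuous_im fun z ↦ Or.inl z.im_pos.ne'

end Literature.NumberTheory.ModularForms.PoincareWeightTwo

end
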